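import Literature.AlgebraicGeometry.ModuliOfAbelianVarieties.SiegelCMLatticeSandwichReciprocity
import Literature.AlgebraicGeometry.ModuliOfAbelianVarieties.SiegelCMStructureFreeRankOneAdelicTopology
import Literature.AlgebraicGeometry.ModuliOfAbelianVarieties.SiegelCMLatticeSandwich
import HarnessLib

/-!
# The COMPLETED lattice sandwich of a CM point and its reciprocity translate (M3a-β closer)
# ([Shimura 1998] §18.3 (18.3a), §6.2; [Milne 2005] §4, Def. 12.8 (60)–(63); [Deligne 1971] 4.18–4.20)

Topic `AlgebraicGeometry/ModuliOfAbelianVarieties`; namespace `Literature.AlgebraicGeometry.ModuliOfAbelianVarieties.CMStructure`.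
Cell hodgecm-mathlib (D-0151), #60 road (row I-7 `SiegelS1`), leaf R60-53: the CLOSER of input (β) «completed sandwich» of the route-ξ′
assembly of M3a (B-p09's junction certificate `RouteXi.cmConjugationIsogenyAll_of (h186) (hα) (hβ)`; A-p06's CENSUS-M3a §5 M3a-β;
B-plan1's Mumford skeleton).  THEOREMS ONLY (no definition, no named fact, no instance, no `sorry`; net Literature debt 0); a banked
GENERIC leaf (director s86 (2)(b)).  HC_CM is proved only modulo the 7 printed citations until rung 0 closes.

## What is proved

For a CM structure `c` ([Deligne1971TravauxShimura] 4.18), a CYCLIC vector `v` (`x ↦ act(x)·v : F = ∏ Kᵢ ≅ ℚ^{2g}`, ★ R60-14), a tuple of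
finite idèles `t = (tᵢ) ∈ ∏ᵢ 𝔸_{Kᵢ,f}^×`, `r ∈ GL_{2g}(𝔸_{ℚ,f})` with matrix `R(t) = c.cmRepMatrix t`, and ANY `a ∈ GL_{2g}(𝔸_{ℚ,f})`:
**`exists_completedSandwich`** — there are non-zero fractional ideals `𝔟ᵢ` of `𝓞_{Kᵢ}` and an integer `M ≥ 1` with
* (β↓) `act(x)·v ∈ Λ_a ⇒ xᵢ ∈ 𝔟ᵢ (∀ i)` — the lattice of `[J, a]` read in `F` lies in `⊕ᵢ 𝔟ᵢ`;
* (β↑) `y ∈ tᵢ𝔟ᵢ ⇒ act(eᵢ(M·y))·v ∈ Λ_{r·a}` — `M·⊕ᵢ tᵢ𝔟ᵢ` lies in the lattice of the translate `[J, r·a]` (Shimura's `t𝔟 = K ∩ t𝔟̂`,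
  ★ `IdeleAction.ideleMulIdeal`);
* (β≡) the TORSION CLAUSE up to `M`: if `tᵢ·(xᵢ mod 𝔟ᵢ) = yᵢ mod tᵢ𝔟ᵢ` for all `i` ([Shimura1998] (18.3a), ★ `IdeleAction.ideleMulEquiv`)
  then `a⁻¹·(act(M·x)·v)^ ≡ (r·a)⁻¹·(act(M·y)·v)^ (mod ẑ^{2g})` ([Milne2005ShimuraVarieties] (63): the two torsion points agree).
And the (62) instance `exists_completedSandwich_cmRecip` with `tᵢ = N_{E,Φᵢ}(s)` (`c.cmRecipMatrix Φ E s = R((N_{E,Φᵢ}(s))ᵢ)` by definition).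

## Proof = composition by name (nothing new is computed here)

1. ★ R60-52 `exists_fractionalIdeal_sandwich_latticeOfGL` (B-p09; ★ R60-40a `exists_fractionalIdeal_sandwich` at the full lattice
   `q_v⁻¹(Λ_a) ⊂ F`): `𝔟`, `N ≥ 1` with (β↓) and the RATIONAL lower half `x ∈ ⊕𝔟ᵢ ⇒ act(N·x)·v ∈ Λ_a`.
2. ★ R60-50 `forall_inv_mulVec_zsmul_mem_of_forall_mem_idealAdeles` (B-p21; module topology of `𝔸_{K,f}` + approximation): the
   rational lower half gives the ADELIC one, `hlowN : N·∏𝔟̂ᵢ ⊆ Θ_v⁻¹(a·ẑ^{2g})`.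
3. ★ R60-48 §5 (B-p13) `act_zsmul_mem_latticeOfGL_mul_of_forall_mem_ideleMulIdeal` at `x := eᵢ(y)` gives (β↑), and
   `forall_inv_mulVec_act_zsmul_sub_mem_of_forall_ideleMulEquiv` gives (β≡); `M := N`.
[cite: Shimura1998, §6.2 p. 42, §18.3 (18.3a) p. 122, §18.6 Thm. 18.6 (pp. 124–125)] [cite: Milne2005ShimuraVarieties, §4 pp. 48–49, Def. 12.8 (60)–(63) pp. 114–116]
[cite: Deligne1971TravauxShimura, 4.18–4.20 pp. 150–152]

## References
* [Shimura1998] G. Shimura, *Abelian Varieties with Complex Multiplication and Modular Functions* (1998), §6.2, §18.3, §18.6.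
* [Milne2005ShimuraVarieties] J. S. Milne, *Introduction to Shimura varieties* (2005), §4 pp. 48–49, Thm. 6.11, Def. 12.8 (60)–(63).
* [Deligne1971TravauxShimura] P. Deligne, *Travaux de Shimura*, Sém. Bourbaki 389 (1971), 4.18–4.20 pp. 150–152.
-/

set_option autoImplicit false

noncomputable section

open scoped nonZeroDivisors
open Module Function NumberField Matrix IsDedekindDomain

namespace Literature.AlgebraicGeometry.ModuliOfAbelianVarieties

namespace CMStructure

open Literature.AlgebraicGeometry.Motives (CMType)
open Literature.NumberTheory.ComplexMultiplication (reflexNormFiniteIdele)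
open Literature.NumberTheory.Automorphic (integralFiniteAdeles)
open Literature.NumberTheory.NumberFields.IdeleAction (idealAdeles ideleMulIdeal ideleMulIdeal_ne_zero ideleMulEquiv)
open Literature.NumberTheory.Adeles (latticeOfGL)

variable {g : ℕ} {δ : Fin g → ℕ} {ι : Type} [Fintype ι] [DecidableEq ι] {K : ι → Type} [∀ i, Field (K i)]
  [∀ i, NumberField (K i)] [∀ i, IsCMField (K i)] (c : CMStructure g δ ι K)

omit [Fintype ι] [∀ i, NumberField (K i)] [∀ i, IsCMField (K i)] in
/-- `N • eᵢ(y) = eᵢ(N • y)` in `F = ∏ Kᵢ`. [folklore] -/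
private theorem natCast_zsmul_single (i : ι) (N : ℕ) (y : K i) :
    ((N : ℤ) • (Pi.single i y : Π i, K i)) = Pi.single i (N • y) := by
  funext j
  by_cases h : j = i
  · subst h
    rw [Pi.smul_apply, Pi.single_eq_same, Pi.single_eq_same, natCast_zsmul]
  · rw [Pi.smul_apply, Pi.single_eq_of_ne h, Pi.single_eq_of_ne h, smul_zero]

/-- **THE COMPLETED SANDWICH (input (β) of the route-ξ′ assembly of M3a).**  For a CM structure `c`, a cyclic vector `v`, a tuple of
finite idèles `t`, `r` with matrix `R(t)` and any `a`: there are non-zero fractional ideals `𝔟ᵢ` and `M ≥ 1` with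
(β↓) `act(x)·v ∈ Λ_a ⇒ xᵢ ∈ 𝔟ᵢ`; (β↑) `y ∈ tᵢ𝔟ᵢ ⇒ act(eᵢ(M·y))·v ∈ Λ_{r·a}`; (β≡) `tᵢ·(xᵢ mod 𝔟ᵢ) = yᵢ mod tᵢ𝔟ᵢ (∀ i) ⇒
a⁻¹·(act(M·x)·v)^ ≡ (r·a)⁻¹·(act(M·y)·v)^ (mod ẑ^{2g})`.  I.e. the lattice of `[J, a]` read in `F` is sandwiched
`M·⊕𝔟ᵢ ⊆ q_v⁻¹(Λ_a) ⊆ ⊕𝔟ᵢ` ([Shimura1998] §6.2 «commensurable»; CM by an ORDER of `F`, [Deligne1971TravauxShimura] 4.18), the sandwich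
COMPLETES (`M·∏𝔟̂ᵢ ⊆ Θ_v⁻¹(a·ẑ^{2g}) ⊆ ∏𝔟̂ᵢ`, ★ R60-50) and is moved by the idèle `t` to the translate `[J, r·a]` (★ R60-48; [Shimura1998]
§18.3 (18.3a), [Milne2005ShimuraVarieties] (60)–(63)).  Composition of ★ R60-52, ★ R60-50, ★ R60-48 by name.
[cite: Shimura1998, §6.2 p. 42; §18.3 (18.3a) p. 122; §18.6 Thm. 18.6 (pp. 124–125)] [cite: Milne2005ShimuraVarieties, §4 pp. 48–49; Def. 12.8 (60)–(63) pp. 114–116]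
[cite: Deligne1971TravauxShimura, 4.18–4.20 pp. 150–152] -/
theorem exists_completedSandwich {v : Fin g ⊕ Fin g → ℚ} (hv : Bijective fun x : Π i, K i => c.act x v)
    (t : Π i, (FiniteAdeleRing (𝓞 (K i)) (K i))ˣ) {r a : GL (Fin g ⊕ Fin g) finAdeleQ}
    (hr : ((r : GL (Fin g ⊕ Fin g) finAdeleQ) : Matrix (Fin g ⊕ Fin g) (Fin g ⊕ Fin g) finAdeleQ) =
      c.cmRepMatrix fun i => (t i : FiniteAdeleRing (𝓞 (K i)) (K i))) :
    ∃ (𝔟 : ∀ i, (FractionalIdeal (𝓞 (K i))⁰ (K i))ˣ) (M : ℕ), M ≠ 0 ∧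
      (∀ x : Π i, K i, c.act x v ∈ latticeOfGL a → ∀ i, x i ∈ (𝔟 i : FractionalIdeal (𝓞 (K i))⁰ (K i))) ∧
      (∀ (i : ι) (y : K i), y ∈ ideleMulIdeal (t i) (𝔟 i : FractionalIdeal (𝓞 (K i))⁰ (K i)) →
        c.act (Pi.single i (M • y)) v ∈ latticeOfGL (r * a)) ∧
      (∀ x y : Π i, K i,
        (∀ i, ideleMulEquiv (t i) (𝔟 i : FractionalIdeal (𝓞 (K i))⁰ (K i)) (𝔟 i).ne_zero
            (Submodule.Quotient.mk (x i)) = Submodule.Quotient.mk (y i)) →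
          ∀ j, ((((a⁻¹ : GL (Fin g ⊕ Fin g) finAdeleQ) : Matrix (Fin g ⊕ Fin g) (Fin g ⊕ Fin g) finAdeleQ) *ᵥ
                  fun j => algebraMap ℚ finAdeleQ (c.act (M • x) v j)) -
                (((r * a)⁻¹ : GL (Fin g ⊕ Fin g) finAdeleQ) : Matrix (Fin g ⊕ Fin g) (Fin g ⊕ Fin g) finAdeleQ) *ᵥ
                  fun j => algebraMap ℚ finAdeleQ (c.act (M • y) v j)) j ∈ integralFiniteAdeles ℚ) := by
  obtain ⟨𝔟, N, hN, hdown, hlowrat⟩ := c.exists_fractionalIdeal_sandwich_latticeOfGL hv a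
  have h𝔟 : ∀ i, (𝔟 i : FractionalIdeal (𝓞 (K i))⁰ (K i)) ≠ 0 := fun i => (𝔟 i).ne_zero
  -- the adelic lower half with the scalar `N` (★ R60-50)
  have hlowN : ∀ u : Π i, FiniteAdeleRing (𝓞 (K i)) (K i),
      (∀ i, u i ∈ idealAdeles (𝔟 i : FractionalIdeal (𝓞 (K i))⁰ (K i))) →
        ∀ j, ((((a⁻¹ : GL (Fin g ⊕ Fin g) finAdeleQ) : Matrix (Fin g ⊕ Fin g) (Fin g ⊕ Fin g) finAdeleQ) *ᵥ
          (c.cmRepMatrix ((N : ℤ) • u) *ᵥ fun j => algebraMap ℚ finAdeleQ (v j))) j ∈ integralFiniteAdeles ℚ) :=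
    c.forall_inv_mulVec_zsmul_mem_of_forall_mem_idealAdeles h𝔟 (N : ℤ)
      (fun x hx => by rw [natCast_zsmul]; exact hlowrat x hx)
  refine ⟨𝔟, N, hN, hdown, fun i y hy => ?_, fun x y hxy j => ?_⟩
  · -- (β↑) at `x := eᵢ(y)` (★ R60-48 §5)
    have hx : ∀ i', (Pi.single i y : Π i, K i) i' ∈ ideleMulIdeal (t i') (𝔟 i' : FractionalIdeal (𝓞 (K i'))⁰ (K i')) := by
      intro i'
      by_cases h : i' = i
      · subst h
        rw [Pi.single_eq_same]
        exact hy
      · rw [Pi.single_eq_of_ne h]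
        exact FractionalIdeal.zero_mem _
    have h := c.act_zsmul_mem_latticeOfGL_mul_of_forall_mem_ideleMulIdeal hr h𝔟 (N : ℤ) hlowN (Pi.single i y) hx
    rwa [natCast_zsmul_single] at h
  · -- (β≡) (★ R60-48 §5)
    have h := c.forall_inv_mulVec_act_zsmul_sub_mem_of_forall_ideleMulEquiv hr h𝔟 (N : ℤ) hlowN x y hxy j
    rwa [natCast_zsmul, natCast_zsmul] at h

/-- **THE (62) INSTANCE**: the completed sandwich at the reciprocity translate `[J, r(s)·a]`, `(r : matrix) = c.cmRecipMatrix Φ E s =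
R((N_{E,Φᵢ}(s))ᵢ)` (★ `cmRecipMatrix` is `cmRepMatrix` at the reflex-norm tuple by definition) — the shape consumed by the route-ξ′ assembly
(`RouteXi.CompletedSandwich`), with Shimura's clause at `tᵢ = N_{E,Φᵢ}(s)` as in ★ `shimura1998_thm18_6` (2).
[cite: Shimura1998, §18.6 Thm. 18.6 (pp. 124–125); §18.3 (18.3a) p. 122] [cite: Milne2005ShimuraVarieties, Def. 12.8 (60)–(63) pp. 114–116]
[cite: Deligne1971TravauxShimura, 4.18–4.20 pp. 150–152] -/
theorem exists_completedSandwich_cmRecip {v : Fin g ⊕ Fin g → ℚ} (hv : Bijective fun x : Π i, K i => c.act x v)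
    (Φ : ∀ i, CMType (K i)) (E : IntermediateField ℚ ℂ) [NumberField ↥E] (s : (FiniteAdeleRing (𝓞 ↥E) ↥E)ˣ)
    {r a : GL (Fin g ⊕ Fin g) finAdeleQ}
    (hr : ((r : GL (Fin g ⊕ Fin g) finAdeleQ) : Matrix (Fin g ⊕ Fin g) (Fin g ⊕ Fin g) finAdeleQ) = c.cmRecipMatrix Φ E s) :
    ∃ (𝔟 : ∀ i, (FractionalIdeal (𝓞 (K i))⁰ (K i))ˣ) (M : ℕ), M ≠ 0 ∧
      (∀ x : Π i, K i, c.act x v ∈ latticeOfGL a → ∀ i, x i ∈ (𝔟 i : FractionalIdeal (𝓞 (K i))⁰ (K i))) ∧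
      (∀ (i : ι) (y : K i),
        y ∈ ideleMulIdeal (reflexNormFiniteIdele (K i) (Φ i) E s) (𝔟 i : FractionalIdeal (𝓞 (K i))⁰ (K i)) →
          c.act (Pi.single i (M • y)) v ∈ latticeOfGL (r * a)) ∧
      (∀ x y : Π i, K i,
        (∀ i, ideleMulEquiv (reflexNormFiniteIdele (K i) (Φ i) E s) (𝔟 i : FractionalIdeal (𝓞 (K i))⁰ (K i)) (𝔟 i).ne_zero
            (Submodule.Quotient.mk (x i)) = Submodule.Quotient.mk (y i)) →
          ∀ j, ((((a⁻¹ : GL (Fin g ⊕ Fin g) finAdeleQ) : Matrix (Fin g ⊕ Fin g) (Fin g ⊕ Fin g) finAdeleQ) *ᵥ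
                  fun j => algebraMap ℚ finAdeleQ (c.act (M • x) v j)) -
                (((r * a)⁻¹ : GL (Fin g ⊕ Fin g) finAdeleQ) : Matrix (Fin g ⊕ Fin g) (Fin g ⊕ Fin g) finAdeleQ) *ᵥ
                  fun j => algebraMap ℚ finAdeleQ (c.act (M • y) v j)) j ∈ integralFiniteAdeles ℚ) :=
  c.exists_completedSandwich hv (fun i => reflexNormFiniteIdele (K i) (Φ i) E s) (by rw [hr]; rfl)

end CMStructure

end Literature.AlgebraicGeometry.ModuliOfAbelianVarieties

end
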